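import Mathlib
import Literature.Computability.Complexity.PseudoComplementCircuit
import Literature.Computability.Complexity.CircuitClassesProofs

/-!
# Crux `MonotoneSuffices` (stmt-PneNP-18026), line `slice-transport` — stub `stub_transport`, part 4:
# the deletion gadget as a `B₂`-circuit

For a ranking `σ : ι ≃ Fin |ι|` of the input coordinates and a deletion count `d`, the transport
gadget maps `x` to `del σ d x`, `(del σ d x) a = x a ∧ [d ≤ #{b | x b ∧ σ b < σ a}]` — it switches off
the `d` lowest-ranked present coordinates (exactly the deletion `x ⊖ lowest_d(σ, supp x)` of parts
1–2, `del_eq_sdiff_lowest`). Reading `[d ≤ #{b | x b ∧ σ b < σ a}]` as Berkowitz's pseudo-complement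
`Th_d(z - z_{σ a})` of the vector `z = x ∘ σ⁻¹` restricted to ranks `< σ a` (the tree's PROVED
`pseudoComplements_cktSize_holds`: all `N` pseudo-complements of `N` variables by ONE
`{∧₂, ∨₂, 0, 1}`-circuit of size `c N ⌊log₂ N⌋²`), one instance per coordinate `a`, the map
`x ↦ del σ d x` has a `B₂`-circuit with `≤ 1 + N · c N ⌊log₂ N⌋² + N` gates, so `C ∘ del σ d` costs
`|C| + c' N⁴` gates over `B₂` (`exists_del_circuit`; `c', N₀` absolute constants). [folklore]
-/

set_option linter.dupNamespace false -- `Summit.PneNP.PneNP.…`: summit = sub-problem name (D-0017 single-conjunct layout)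

namespace Summit.PneNP.PneNP.Theorems.MonotoneSuffices.SliceTransport

open Finset Literature.Computability.Complexity

variable {ι : Type*} [Fintype ι]

/-- **The gadget is the deletion of the lowest-ranked `d` present coordinates**: pointwise,
`x a ∧ [d ≤ #{b | x b ∧ σ b < σ a}] = x a ∧ a ∉ lowest_d(σ, supp x)`. [folklore] -/
theorem del_eq_sdiff_lowest [DecidableEq ι] (σ : ι ≃ Fin (Fintype.card ι)) (d : ℕ) (x : ι → Bool) :
    (fun a => x a && decide (d ≤ #(univ.filter fun b => x b = true ∧ σ b < σ a))) =
      fun a => x a && !decide (a ∈ (univ.filter fun a => x a = true).filter fun a =>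
        #((univ.filter fun a => x a = true).filter fun c => σ c < σ a) < d) := by
  funext a
  cases hxa : x a
  · simp
  · simp only [Bool.true_and, mem_filter, mem_univ, hxa, true_and, filter_filter]
    by_cases h : d ≤ #(univ.filter fun b => x b = true ∧ σ b < σ a)
    · rw [decide_eq_true h]
      symm
      simp only [Bool.not_eq_true', decide_eq_false_iff_not, not_lt]
      exact h
    · rw [decide_eq_false h]
      symm
      simp only [Bool.not_eq_false', decide_eq_true_eq, not_le] at h ⊢
      exact h

/-- The pseudo-complement instance at coordinate `a`: feeding `Th_d(z - z_{σ a})` the vector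
`z j = x (σ⁻¹ j)` for ranks `j < σ a` and `0` otherwise computes `[d ≤ #{b | x b ∧ σ b < σ a}]`.
[folklore] -/
theorem pseudoComplement_rank (σ : ι ≃ Fin (Fintype.card ι)) (d : ℕ) (x : ι → Bool) (a : ι) :
    pseudoComplement d (σ a)
        (fun j => Sum.elim x (fun _ : Unit => false)
          (if j < σ a then Sum.inl (σ.symm j) else Sum.inr ())) =
      decide (d ≤ #(univ.filter fun b => x b = true ∧ σ b < σ a)) := by
  unfold pseudoComplement
  congr 1
  apply propext
  -- the two counted sets correspond under `σ`
  have hcard : #(univ.filter fun j : Fin (Fintype.card ι) => j ≠ σ a ∧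
      Sum.elim x (fun _ : Unit => false) (if j < σ a then Sum.inl (σ.symm j) else Sum.inr ()) = true) =
      #(univ.filter fun b => x b = true ∧ σ b < σ a) := by
    refine card_bij (fun j _ => σ.symm j) (fun j hj => ?_) (fun j₁ _ j₂ _ h => σ.symm.injective h)
      (fun b hb => ⟨σ b, ?_, by simp⟩)
    · rw [mem_filter] at hj ⊢
      obtain ⟨-, hne, hval⟩ := hj
      by_cases hlt : j < σ a
      · rw [if_pos hlt, Sum.elim_inl] at hval
        exact ⟨mem_univ _, hval, by simpa using hlt⟩
      · rw [if_neg hlt, Sum.elim_inr] at hval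
        exact absurd hval Bool.false_ne_true
    · rw [mem_filter] at hb ⊢
      obtain ⟨-, hxb, hlt⟩ := hb
      refine ⟨mem_univ _, ne_of_lt hlt, ?_⟩
      rw [if_pos hlt, Sum.elim_inl, Equiv.symm_apply_apply]
      exact hxb
  rw [hcard]

/-- **The deletion gadget composed with a `B₂`-circuit is a `B₂`-circuit with additive overhead
`c N⁴`.** There are absolute constants `c, N₀` such that for every finite coordinate type `ι` with
`|ι| ≥ N₀`, every circuit `C` over `B₂` on `ι`, every ranking `σ` and count `d`, some circuit `C₁`
over `B₂` with `|C₁| ≤ |C| + c |ι|⁴` computes `x ↦ C (del σ d x)`. [folklore] -/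
theorem exists_del_circuit : ∃ c N₀ : ℕ, ∀ (ι : Type*) [Fintype ι] [DecidableEq ι],
    N₀ ≤ Fintype.card ι → ∀ C : Circuit ι, C.IsOver B2 → ∀ (σ : ι ≃ Fin (Fintype.card ι)) (d : ℕ),
      ∃ C₁ : Circuit ι, C₁.IsOver B2 ∧ C₁.size ≤ C.size + c * Fintype.card ι ^ 4 ∧
        ∀ x, C₁.eval x = C.eval (fun a => x a && decide (d ≤ #(univ.filter fun b => x b = true ∧ σ b < σ a))) := by
  obtain ⟨c, n₀, hpc⟩ := pseudoComplements_cktSize_holds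
  refine ⟨c + 2, n₀ + 1, fun ι _ _ hN C hC σ d => ?_⟩
  classical
  have hN0 : n₀ ≤ Fintype.card ι := by omega
  have hN1 : 1 ≤ Fintype.card ι := by omega
  -- the pseudo-complement block on `Fin N`, over `B₂`
  have hsub : monotoneBasis01 ⊆ B2 := by
    intro g hg
    simp only [monotoneBasis01, Set.mem_insert_iff] at hg
    rcases hg with rfl | rfl | hg
    · exact Nat.zero_le 2
    · exact Nat.zero_le 2
    · exact deMorganBasis_subset_B2 (monotoneBasis_subset_deMorgan hg)
  have hblk : CktSize B2 (fun (z : Fin (Fintype.card ι) → Bool) (i : Fin (Fintype.card ι)) => pseudoComplement d i z)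
      (c * (Fintype.card ι * Nat.log 2 (Fintype.card ι) ^ 2)) :=
    (hpc (Fintype.card ι) hN0 d).basis_mono hsub
  -- one re-wired instance per coordinate, reading a fake constant `false`
  let ρ : ι → Fin (Fintype.card ι) → ι ⊕ Unit := fun a j => if j < σ a then Sum.inl (σ.symm j) else Sum.inr ()
  have hB : CktSize B2 (fun (w : ι ⊕ Unit → Bool) (a : ι) => pseudoComplement d (σ a) (fun j => w (ρ a j)))
      (Fintype.card ι * (c * (Fintype.card ι * Nat.log 2 (Fintype.card ι) ^ 2))) :=
    CktSize.pi_const (κ := ι) fun a => (hblk.rewire (ρ a)).outMap (fun _ : Unit => σ a)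
  have hA : CktSize B2 (fun (x : ι → Bool) => Sum.elim x (fun _ : Unit => false)) (0 + 1) :=
    (CktSize.id B2).pair (cktSize_const ι false)
  have hAB := hA.comp hB
  -- conjunction with the coordinate itself
  have hAnd : CktSize B2 (fun (w : ι ⊕ ι → Bool) (a : ι) => (w (Sum.inl a) && w (Sum.inr a)))
      (Fintype.card ι * 1) :=
    CktSize.pi_const (κ := ι) fun a => cktSize_and (ι := ι ⊕ ι) (Sum.inl a) (Sum.inr a)
  have hDel := ((CktSize.id B2).pair hAB).comp hAnd
  -- then the given circuit
  have hFin := hDel.comp (C.cktSize_eval hC)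
  obtain ⟨C₁, hC₁B, hC₁s, hC₁e⟩ := hFin.toCircuit
  refine ⟨C₁, hC₁B, hC₁s.trans ?_, fun x => ?_⟩
  · -- size bookkeeping: `(1 + N·c N L²) + N + |C| ≤ |C| + (c+2) N⁴`
    set N := Fintype.card ι with hNdef
    have hL : Nat.log 2 N ≤ N := (Nat.log_lt_of_lt_pow (by omega) (Nat.lt_two_pow_self)).le
    have h1 : N * Nat.log 2 N ^ 2 ≤ N ^ 3 := by
      calc N * Nat.log 2 N ^ 2 ≤ N * N ^ 2 := Nat.mul_le_mul_left _ (Nat.pow_le_pow_left hL 2)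
        _ = N ^ 3 := by ring
    have h2 : N * (c * (N * Nat.log 2 N ^ 2)) ≤ c * N ^ 4 := by
      calc N * (c * (N * Nat.log 2 N ^ 2)) ≤ N * (c * N ^ 3) := Nat.mul_le_mul_left _ (Nat.mul_le_mul_left _ h1)
        _ = c * N ^ 4 := by ring
    have h3 : 1 + N ≤ 2 * N ^ 4 := by
      have : N ≤ N ^ 4 := by
        calc N = N ^ 1 := (pow_one N).symm
          _ ≤ N ^ 4 := Nat.pow_le_pow_right hN1 (by norm_num)
      have h1' : 1 ≤ N ^ 4 := Nat.one_le_pow _ _ hN1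
      omega
    nlinarith [h2, h3]
  · rw [hC₁e]
    congr 1
    funext a
    simp only [Sum.elim_inl, Sum.elim_inr]
    rw [pseudoComplement_rank σ d x a]

/-- **transport_gadget** (registered helper sub-goal of stmt-PneNP-18026 for `stub_transport`,
part 4): the deletion gadget composed with a `B₂`-circuit (`exists_del_circuit`). [folklore] -/
theorem transport_gadget :
    ∃ c N₀ : ℕ, ∀ (ι : Type*) [Fintype ι] [DecidableEq ι], N₀ ≤ Fintype.card ι → ∀ C : Literature.Computability.Complexity.Circuit ι, C.IsOver Literature.Computability.Complexity.B2 → ∀ (σ : ι ≃ Fin (Fintype.card ι)) (d : ℕ), ∃ C₁ : Literature.Computability.Complexity.Circuit ι, C₁.IsOver Literature.Computability.Complexity.B2 ∧ C₁.size ≤ C.size + c * Fintype.card ι ^ 4 ∧ ∀ x, C₁.eval x = C.eval (fun a => x a && decide (d ≤ #(Finset.univ.filter fun b => x b = true ∧ σ b < σ a))) :=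
  exists_del_circuit

end Summit.PneNP.PneNP.Theorems.MonotoneSuffices.SliceTransport
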